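import Summits.CriticalPhenomena.PercolationContinuityZ3.Theorems.PercNearOneGluingNoHeavyLowerTailSahiGridPatternZDecomp

/-!
# `NoHeavyLowerTail` (crux stmt-CriticalPhenomena-4575), Sahi programme P1: **Θ-POSITIVITY** — the off-diagonal part of every slice of
# the pattern functional is a nonnegative bilinear form on up-sets, every dimension

Support file (Sahi cell, seat `prim-sahi-p1`, generation 8; `--supports stmt-CriticalPhenomena-4575`).  Pure proofs, no definitions, no
`sorry`, standard axioms.

THE MATHEMATICS.  By `sliceForm_eq` (`…SliceForm`) the slice of the pattern functional at an up-set `A ⊆ [3]^d` is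
`β_A(q,r) = [q=r](2^{d+1}1_A(q) − ν_A(q)) − Θ_A(q,r)`, `Θ_A(q,r) = [q δ̸ r](1_A(q) + 1_A(r) − 1_A(q̄r))` (`thetaVal`).  THIS FILE proves,
for every `d` and every up-set `D`:
* `sum_thetaVal_col_nonneg` (**columns of `Θ_D` lie in the dual cone**): for every up-set `U` and EVERY point `y`,
  `Σ_{q ∈ U} Θ_D(q,y) ≥ 0`.  PROOF: for fixed `y` the points `q δ̸ y` form the Boolean cube `Q_y` around `y` (chart `fromSet y` of
  `…ZDecomp`), `q̄y` is the complement there, and `Σ_{q∈U} Θ_D(q,y) = #(𝒰∩𝒟) + 1_D(y)·#𝒰 − #(𝒰∩𝒟ᶜˢ)` for the traced upper families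
  (`sum_thetaVal_eq_card`); `#(𝒰 ∩ 𝒟ᶜˢ) ≤ #(𝒰 ∩ 𝒟)` is Kleitman-then-Harris (`card_inter_compls_le`, `…ZProfile`).
* `theta_bilin_nonneg`: hence `Σ_{q∈U} Σ_{r∈V} Θ_D(q,r) ≥ 0` for every up-set `U` and EVERY `V` — in particular `Θ_D ∈ K* ⊗ K*`
  (columnwise: `Θ_D = Σ_y Θ_D(·,y) ⊗ δ_y`), the "Θ-positivity" observed by exact LP for `d ≤ 3` (all 4 + 20 + 980 up-sets) in the
  generation-8 memo §3 (S2), now a theorem in all dimensions.  In counting form: `N(D∩U, V) + N(U, D∩V) ≥ M(D,U,V)`.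
* `sStarD_le_diag` (consequence): `sStarD A B C ≤ Σ_{q ∈ B∩C} (2^{d+1}·1_A(q) − ν_A(q)) = 2^{d+1}|A∩B∩C| − N(A, B∩C)` for up-sets —
  an UPPER bound on the pattern functional (whose conjectured LOWER bound `0` is `PatternPos d`).
Nothing conjectural is asserted. [this work]
-/

namespace Summit.CriticalPhenomena.PercolationContinuityZ3.Theorems.SahiGridPattern

open Finset SahiGrid3
open scoped BigOperators FinsetFamily

variable {d : ℕ}

/-- Product of two indicators as one indicator. [this work] -/
theorem ind_mul_ite {Y : Type*} [DecidableEq Y] (A B : Finset Y) (x y : Y) :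
    ind A x * ind B y = if (x ∈ A ∧ y ∈ B) then 1 else 0 := by
  unfold ind; split_ifs <;> simp_all

/-- **A column of `Θ_D` through the chart around `y`**: with `𝒰 = fam y U`, `𝒟 = fam y D`,
`Σ_{q∈U} Θ_D(q,y) = #(𝒰 ∩ 𝒟) + 1_D(y)·#𝒰 − #(𝒰 ∩ 𝒟ᶜˢ)`. [this work] -/
theorem sum_thetaVal_eq_card (D U : Finset (Pd d)) (y : Pd d) :
    (∑ q ∈ U, thetaVal D q y) =
      ((fam y U ∩ fam y D).card : ℤ) + ind D y * ((fam y U).card : ℤ) - ((fam y U ∩ (fam y D)ᶜˢ).card : ℤ) := by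
  classical
  -- pass to a sum over all points with an indicator, then to the cube around `y`, then to the chart
  have h1 : (∑ q ∈ U, thetaVal D q y) = ∑ q : Pd d, (if q ∈ U then thetaVal D q y else 0) :=
    (Finset.sum_ite_mem_eq U (fun q => thetaVal D q y)).symm
  have h2 : (∑ q : Pd d, (if q ∈ U then thetaVal D q y else 0)) =
      ∑ q ∈ univ.filter (fun q : Pd d => TotDist q y = true),
        ind U q * (ind D q + ind D y - ind D (thirdPt q y)) := by
    rw [Finset.sum_filter]
    refine Finset.sum_congr rfl fun q _ => ?_
    unfold thetaVal ind
    by_cases hq : q ∈ U <;> by_cases ht : TotDist q y = true <;> simp [hq, ht]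
  rw [h1, h2, sum_totDist_eq_sum_sets]
  simp only [thirdPt_fromSet, mul_add, mul_sub, Finset.sum_add_distrib, Finset.sum_sub_distrib]
  have e1 : (∑ T : Finset (Fin d), ind U (fromSet y T) * ind D (fromSet y T)) = ((fam y U ∩ fam y D).card : ℤ) := by
    simp only [ind_mul_ite]; rw [sum_ite_eq_card]; congr 2; ext T; simp [mem_fam]
  have e2 : (∑ T : Finset (Fin d), ind U (fromSet y T) * ind D y) = ind D y * ((fam y U).card : ℤ) := by
    have : ∀ T : Finset (Fin d), ind U (fromSet y T) * ind D y = ind D y * (if fromSet y T ∈ U then 1 else 0) := by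
      intro T; unfold ind; split_ifs <;> simp
    simp only [this]
    rw [← Finset.mul_sum, sum_ite_eq_card]
    rfl
  have e3 : (∑ T : Finset (Fin d), ind U (fromSet y T) * ind D (fromSet y Tᶜ)) = ((fam y U ∩ (fam y D)ᶜˢ).card : ℤ) := by
    simp only [ind_mul_ite]; rw [sum_ite_eq_card]; congr 2; ext T; simp [mem_fam, mem_compls]
  rw [e1, e2, e3]

/-- **Columns of `Θ_D` lie in the dual cone of up-sets** (every dimension): for up-sets `D, U` of `[3]^d` and every point `y`,
`Σ_{q∈U} Θ_D(q,y) ≥ 0`.  (Kleitman, then Harris, on the Boolean cube around `y`.) [this work] -/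
theorem sum_thetaVal_col_nonneg {D U : Finset (Pd d)} (hD : IsUpperSet (D : Set (Pd d))) (hU : IsUpperSet (U : Set (Pd d)))
    (y : Pd d) : 0 ≤ ∑ q ∈ U, thetaVal D q y := by
  rw [sum_thetaVal_eq_card]
  have k : ((fam y U ∩ (fam y D)ᶜˢ).card : ℤ) ≤ ((fam y U ∩ fam y D).card : ℤ) := by
    exact_mod_cast card_inter_compls_le (isUpperSet_fam y hU) (isUpperSet_fam y hD)
  have hind : 0 ≤ ind D y := by unfold ind; split_ifs <;> norm_num
  have hcard : (0 : ℤ) ≤ ((fam y U).card : ℤ) := by exact_mod_cast Nat.zero_le _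
  nlinarith

/-- **Θ-positivity** (every dimension): `Σ_{q∈U} Σ_{r∈V} Θ_D(q,r) ≥ 0` for up-sets `D, U` and ANY finset `V` — the off-diagonal part of
every slice is a nonnegative bilinear form on (up-set, anything), columnwise in `K*`; in counting form `N(D∩U,V) + N(U,D∩V) ≥ M(D,U,V)`.
[this work] -/
theorem theta_bilin_nonneg {D U : Finset (Pd d)} (hD : IsUpperSet (D : Set (Pd d))) (hU : IsUpperSet (U : Set (Pd d)))
    (V : Finset (Pd d)) : 0 ≤ ∑ q ∈ U, ∑ r ∈ V, thetaVal D q r := by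
  rw [Finset.sum_comm]
  exact Finset.sum_nonneg fun r _ => sum_thetaVal_col_nonneg hD hU r

/-- Double sum of a diagonal indicator. [this work] -/
theorem sum_sum_ite_eq_diag (B C : Finset (Pd d)) (f : Pd d → ℤ) :
    (∑ q ∈ B, ∑ r ∈ C, if q = r then f q else 0) = ∑ q ∈ B ∩ C, f q := by
  have h : ∀ q ∈ B, (∑ r ∈ C, if q = r then f q else 0) = if q ∈ C then f q else 0 := fun q _ => Finset.sum_ite_eq C q _
  rw [Finset.sum_congr rfl h, ← Finset.sum_filter, Finset.filter_mem_eq_inter]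

/-- **Upper bound on the pattern functional** (every dimension): for up-sets `A, B, C` of `[3]^d`,
`sStarD A B C ≤ Σ_{q ∈ B∩C} (2^{d+1}·1_A(q) − ν_A(q))` (`= 2^{d+1}|A∩B∩C| − N(A, B∩C)`). [this work] -/
theorem sStarD_le_diag {A B C : Finset (Pd d)} (hA : IsUpperSet (A : Set (Pd d))) (hB : IsUpperSet (B : Set (Pd d))) :
    sStarD A B C ≤ ∑ q ∈ B ∩ C, (2 * (2 : ℤ) ^ d * ind A q - (nuCount A q : ℤ)) := by
  have hswap : sStarD A B C = ∑ q ∈ B, ∑ r ∈ C, ∑ p ∈ A, tcD p q r := by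
    rw [sStarD_eq_sum_tcD, Finset.sum_comm]
    refine Finset.sum_congr rfl fun q _ => ?_
    rw [Finset.sum_comm]
  rw [hswap]
  have hpt : ∀ q ∈ B, (∑ r ∈ C, ∑ p ∈ A, tcD p q r) =
      ∑ r ∈ C, ((if q = r then 2 * (2 : ℤ) ^ d * ind A q - (nuCount A q : ℤ) else 0) - thetaVal A q r) :=
    fun q _ => Finset.sum_congr rfl fun r _ => sliceForm_eq A q r
  rw [Finset.sum_congr rfl hpt]
  have hsplit : (∑ q ∈ B, ∑ r ∈ C, ((if q = r then 2 * (2 : ℤ) ^ d * ind A q - (nuCount A q : ℤ) else 0) - thetaVal A q r)) =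
      (∑ q ∈ B ∩ C, (2 * (2 : ℤ) ^ d * ind A q - (nuCount A q : ℤ))) - ∑ q ∈ B, ∑ r ∈ C, thetaVal A q r := by
    rw [← sum_sum_ite_eq_diag B C (fun q => 2 * (2 : ℤ) ^ d * ind A q - (nuCount A q : ℤ)), ← Finset.sum_sub_distrib]
    exact Finset.sum_congr rfl fun q _ => Finset.sum_sub_distrib _ _
  rw [hsplit]
  have hθ := theta_bilin_nonneg hA hB C
  linarith

end Summit.CriticalPhenomena.PercolationContinuityZ3.Theorems.SahiGridPattern
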